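import Mathlib
import Summits.ResolutionOfSingularities.ResolutionOfSingularities.Theorems.WildQuotientsWildQuotientResolutionJordanFourTwistedChartDefs

/-!
# V4U piece T — the twisted root chart: equivariance T-i, deck symmetry T-ii, `I₆ ↦ (s⁶)` T-iv (J₄, `μ₂`-vertex)

(crux stmt-ResolutionOfSingularities-15640 `WildQuotients.WildQuotientResolution`, line `Sketch`,
sector `|G| = p`; programme V4U of `L/w45c/CHAIN.md` v6 §4 row stub-1 (T1), design of record
`L/w45c/V4U-DESIGN.md` §3 (planner res-L1-w45c-plan-1; cleared forms kernel-checked in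
`L/w45c/W45cPlanSignaturesV6.lean` V6.1, here transported to the project vocabulary of
`…JordanFourTwistedChartDefs`). [OURS · L1 W4.5c] — NOT a statement of any manuscript; replaces the
role of no printed item. Prover res-L1-w45c-stub-1.)

Slots `s = X b`, `A = X a`, `ξ = X c`, `η = X d`; `ψ_T = twistedChart k n a b c d`; `2, 3 ∈ kˣ`
(hypotheses `(2 : k) ≠ 0`, `(3 : k) ≠ 0`, i.e. `char k ≥ 5`: `two_ne_zero_of_charP`,
`three_ne_zero_of_charP`). All maps `σ` (the `J₄` datum), `Σ_T` (the translation `ξ ↦ ξ + s`) and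
`ι` (the deck involution `(s, A, ξ) ↦ (−s, −A, −ξ)`) are ARBITRARY `k`-algebra endomorphisms given
by their laws on the variables.

* T-i `twistedChart_comp_eq` / `twistedChart_map`: `ψ_T ∘ σ = Σ_T ∘ ψ_T` (and the four generator
  identities `translate_twistedChart_X_a/b/c/d`) — on the chart `σ` IS a polynomial translation.
* T-ii `deck_comp_twistedChart` / `deck_twistedChart`: `ι ∘ ψ_T = ψ_T`; `deck_twistedQ`.
* (T-iii and T-v — the invariants `H'`, `T'`, `M`, `Δ₇` on the chart and the inverse map — are in
  `…JordanFourTwistedChartInvariants.lean`.)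
* T-iv `twistedChart_I6 : ψ_T(g_j) = s⁶ · q_j` for the vector of record of `I₆` and the `q`-vector
  `twistedCofactor`; `isCoprime_twistedCofactor_zero_four`; `map_twistedChart_span_I6 :
  I₆ · k[s,A,ξ,η] = (s⁶)`.
Method: push the maps through (`simp only [map_*]`), then `ring` / `linear_combination` with the
relations `2·C 2⁻¹ = 1`, `3·C 3⁻¹ = 1`, `6·C 6⁻¹ = 1` (cofactors machine-extracted from the affine
dependence on the constants; identities of degree `> 1` in the constants are reduced to these via the
defining relation of `Δ₇` and cancellation of non-zero-divisors).
-/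

-- single-problem summit: the doubled namespace component `ResolutionOfSingularities` is forced
set_option linter.dupNamespace false

noncomputable section

open MvPolynomial

namespace Summit.ResolutionOfSingularities.ResolutionOfSingularities.Theorems.WildQuotientResolution.JordanFour

section Constants

variable (k : Type) [Field k] (n : ℕ)

/-- In characteristic `p ≥ 5` (indeed `p ≠ 2`), `2 ≠ 0` in `k`. [folklore] -/
theorem two_ne_zero_of_charP (p : ℕ) (hp5 : 5 ≤ p) [CharP k p] : (2 : k) ≠ 0 := by
  intro h
  have hdvd : p ∣ 2 := (CharP.cast_eq_zero_iff k p 2).mp (by exact_mod_cast h)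
  have := Nat.le_of_dvd two_pos hdvd
  omega

/-- In characteristic `p ≥ 5` (indeed `p ≠ 3`), `3 ≠ 0` in `k`. [folklore] -/
theorem three_ne_zero_of_charP (p : ℕ) (hp5 : 5 ≤ p) [CharP k p] : (3 : k) ≠ 0 := by
  intro h
  have hdvd : p ∣ 3 := (CharP.cast_eq_zero_iff k p 3).mp (by exact_mod_cast h)
  have := Nat.le_of_dvd (by norm_num) hdvd
  omega

/-- `2 · C(2⁻¹) = 1` in `k[x]`. [folklore] -/
theorem two_mul_C_inv_two (h2 : (2 : k) ≠ 0) : (2 : MvPolynomial (Fin n) k) * C (2⁻¹ : k) = 1 := by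
  rw [← map_ofNat C 2, ← map_mul, mul_inv_cancel₀ h2, map_one]

/-- `3 · C(3⁻¹) = 1` in `k[x]`. [folklore] -/
theorem three_mul_C_inv_three (h3 : (3 : k) ≠ 0) :
    (3 : MvPolynomial (Fin n) k) * C (3⁻¹ : k) = 1 := by
  rw [← map_ofNat C 3, ← map_mul, mul_inv_cancel₀ h3, map_one]

/-- `6 · C(6⁻¹) = 1` in `k[x]` (`2, 3 ∈ kˣ`). [folklore] -/
theorem six_mul_C_inv_six (h2 : (2 : k) ≠ 0) (h3 : (3 : k) ≠ 0) :
    (6 : MvPolynomial (Fin n) k) * C (6⁻¹ : k) = 1 := by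
  have h6 : (6 : k) ≠ 0 := by
    rw [show (6 : k) = 2 * 3 by norm_num]
    exact mul_ne_zero h2 h3
  rw [← map_ofNat C 6, ← map_mul, mul_inv_cancel₀ h6, map_one]

/-- `6 ≠ 0` in `k[x]` (`2, 3 ∈ kˣ`). [folklore] -/
theorem six_ne_zero' (h2 : (2 : k) ≠ 0) (h3 : (3 : k) ≠ 0) : (6 : MvPolynomial (Fin n) k) ≠ 0 := by
  intro h
  have h1 := six_mul_C_inv_six k n h2 h3
  rw [h, zero_mul] at h1
  exact zero_ne_one h1

end Constants

section Identities

variable (k : Type) [Field k] (n : ℕ) (a b c d : Fin n)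
  (hab : a ≠ b) (hac : a ≠ c) (had : a ≠ d) (hbc : b ≠ c) (hbd : b ≠ d) (hcd : c ≠ d)

/-! ### Cleared forms of `P` and `ψ_T(x_d)` -/

/-- `2P = 2ξ + 2s + A(ξ² − sξ − η)`. [OURS · L1 W4.5c] -/
theorem two_mul_twistedP (h2 : (2 : k) ≠ 0) :
    2 * twistedP k n a b c d = 2 * X c + 2 * X b + X a * (X c ^ 2 - X b * X c - X d) := by
  have h2u := two_mul_C_inv_two k n h2
  simp only [twistedP]
  linear_combination (X a * (X c ^ 2 - X b * X c - X d)) * h2u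

include had hbd hcd in
/-- `6·ψ_T(x_d) = 3ξ² + 3sξ − η + 2s² + A(ξ³ − 3sξ² − 3ξη + 2s²ξ)`. [OURS · L1 W4.5c] -/
theorem six_mul_twistedChart_X_d (h2 : (2 : k) ≠ 0) (h3 : (3 : k) ≠ 0) :
    6 * twistedChart k n a b c d (X d) =
      3 * X c ^ 2 + 3 * (X b * X c) - X d + 2 * X b ^ 2 +
        X a * (X c ^ 3 - 3 * (X b * X c ^ 2) - 3 * (X c * X d) + 2 * (X b ^ 2 * X c)) := by
  have h2u := two_mul_C_inv_two k n h2
  have h3v := three_mul_C_inv_three k n h3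
  have h6w := six_mul_C_inv_six k n h2 h3
  rw [twistedChart_X_d k n a b c d had hbd hcd]
  linear_combination (3 * (X b * X c) + 3 * X c ^ 2) * h2u + (2 * X b ^ 2) * h3v +
    (2 * (X b ^ 2 * X a * X c) - 3 * (X b * X a * X c ^ 2) + X a * X c ^ 3 - 3 * (X a * X c * X d) -
      X d) * h6w

/-! ### T-i EQUIVARIANCE `ψ_T ∘ σ = Σ_T ∘ ψ_T`: on the chart `σ` is the translation `ξ ↦ ξ + s`
(`Σ_T (X c) = X c + X b`, all other variables fixed), for ANY `k`-algebra endomorphisms `σ`, `Σ_T`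
with the stated laws. -/

variable (τ : MvPolynomial (Fin n) k →ₐ[k] MvPolynomial (Fin n) k)
  (hτc : τ (X c) = X c + X b) (hτ : ∀ i, i ≠ c → τ (X i) = X i)

include hac hτ in
/-- `Σ_T ψ_T(x_a) = ψ_T(x_a)` (`= ψ_T(σ x_a)`). [OURS · L1 W4.5c] -/
theorem translate_twistedChart_X_a (hbc : b ≠ c) :
    τ (twistedChart k n a b c d (X a)) = twistedChart k n a b c d (X a) := by
  rw [twistedChart_X_a, map_mul, map_pow, hτ a hac, hτ b hbc]

include hab hac hbc hτc hτ in
/-- `Σ_T ψ_T(x_b) = ψ_T(x_b) + ψ_T(x_a)` (`= ψ_T(σ x_b)`). [OURS · L1 W4.5c] -/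
theorem translate_twistedChart_X_b :
    τ (twistedChart k n a b c d (X b)) =
      twistedChart k n a b c d (X b) + twistedChart k n a b c d (X a) := by
  rw [twistedChart_X_b k n a b c d hab, twistedChart_X_a]
  simp only [map_mul, map_pow, map_add, map_one, hτ a hac, hτ b hbc, hτc]
  ring

include hab hac hbc hcd hτc hτ in
/-- `Σ_T ψ_T(x_c) = ψ_T(x_c) + ψ_T(x_b)` (`= ψ_T(σ x_c)`): the heart of the twisted chart — the
correction `(A/2)(ξ² − sξ − η)` absorbs the non-linearity. [OURS · L1 W4.5c] -/
theorem translate_twistedChart_X_c (h2 : (2 : k) ≠ 0) :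
    τ (twistedChart k n a b c d (X c)) =
      twistedChart k n a b c d (X c) + twistedChart k n a b c d (X b) := by
  have h2u := two_mul_C_inv_two k n h2
  rw [twistedChart_X_c k n a b c d hac hbc, twistedChart_X_b k n a b c d hab]
  simp only [twistedP, map_mul, map_pow, map_add, map_sub, MvPolynomial.algHom_C, MvPolynomial.algebraMap_eq, hτ a hac,
    hτ b hbc, hτ d (Ne.symm hcd), hτc]
  linear_combination (X b ^ 2 * X a * X c) * h2u

include hac had hbc hbd hcd hτc hτ in
/-- `Σ_T ψ_T(x_d) = ψ_T(x_d) + ψ_T(x_c)` (`= ψ_T(σ x_d)`). [OURS · L1 W4.5c] -/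
theorem translate_twistedChart_X_d (h2 : (2 : k) ≠ 0) (h3 : (3 : k) ≠ 0) :
    τ (twistedChart k n a b c d (X d)) =
      twistedChart k n a b c d (X d) + twistedChart k n a b c d (X c) := by
  have h2u := two_mul_C_inv_two k n h2
  have h3v := three_mul_C_inv_three k n h3
  have h6w := six_mul_C_inv_six k n h2 h3
  refine mul_left_cancel₀ (six_ne_zero' k n h2 h3) ?_
  rw [twistedChart_X_d k n a b c d had hbd hcd, twistedChart_X_c k n a b c d hac hbc]
  simp only [twistedP, map_mul, map_pow, map_add, map_sub, map_ofNat, MvPolynomial.algHom_C, MvPolynomial.algebraMap_eq,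
    hτ a hac, hτ b hbc, hτ d (Ne.symm hcd), hτc]
  linear_combination (3 * (X b ^ 2 * X a * X c) + 6 * X b ^ 2 - 3 * (X b * X a * X c ^ 2) +
      3 * (X b * X a * X d) + 6 * (X b * X c)) * h2u +
    (-(3 * (X b ^ 2 * X a * X c)) + 3 * (X b * X a * X c ^ 2) - 3 * (X b * X a * X d)) * h6w

variable (σ : MvPolynomial (Fin n) k →ₐ[k] MvPolynomial (Fin n) k)
  (hσb : σ (X b) = X b + X a) (hσc : σ (X c) = X c + X b) (hσd : σ (X d) = X d + X c)
  (hσ : ∀ i, i ≠ b → i ≠ c → i ≠ d → σ (X i) = X i)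

include hab hac had hbc hbd hcd hτc hτ hσb hσc hσd hσ in
/-- **T-i EQUIVARIANCE `ψ_T ∘ σ = Σ_T ∘ ψ_T`** for the `J₄` datum `σ` (`x_b ↦ x_b + x_a`,
`x_c ↦ x_c + x_b`, `x_d ↦ x_d + x_c`, rest fixed) and the translation `Σ_T` (`ξ ↦ ξ + s`, rest
fixed): on the twisted chart the wild automorphism IS a polynomial Artin–Schreier translation.
[OURS · L1 W4.5c] -/
theorem twistedChart_comp_eq (h2 : (2 : k) ≠ 0) (h3 : (3 : k) ≠ 0) :
    (twistedChart k n a b c d).comp σ = τ.comp (twistedChart k n a b c d) := by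
  refine MvPolynomial.algHom_ext fun i => ?_
  change twistedChart k n a b c d (σ (X i)) = τ (twistedChart k n a b c d (X i))
  by_cases hib : i = b
  · subst hib
    rw [hσb, map_add, translate_twistedChart_X_b k n a i c d hab hac hbc τ hτc hτ]
  by_cases hic : i = c
  · subst hic
    rw [hσc, map_add, translate_twistedChart_X_c k n a b i d hab hac hbc hcd τ hτc hτ h2]
  by_cases hid : i = d
  · subst hid
    rw [hσd, map_add, translate_twistedChart_X_d k n a b c i hac had hbc hbd hcd τ hτc hτ h2 h3]
  rw [hσ i hib hic hid]
  by_cases hia : i = a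
  · subst hia
    rw [translate_twistedChart_X_a k n i b c d hac τ hτ hbc]
  rw [twistedChart_X_of_ne k n a b c d i hia hib hic hid, hτ i hic]

include hab hac had hbc hbd hcd hτc hτ hσb hσc hσd hσ in
/-- T-i pointwise: `ψ_T(σ f) = Σ_T(ψ_T f)` for every `f`. [OURS · L1 W4.5c] -/
theorem twistedChart_map (h2 : (2 : k) ≠ 0) (h3 : (3 : k) ≠ 0) (f : MvPolynomial (Fin n) k) :
    twistedChart k n a b c d (σ f) = τ (twistedChart k n a b c d f) := by
  have h := twistedChart_comp_eq k n a b c d hab hac had hbc hbd hcd τ hτc hτ σ hσb hσc hσd hσ h2 h3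
  exact congrArg (fun φ : MvPolynomial (Fin n) k →ₐ[k] MvPolynomial (Fin n) k => φ f) h

/-! ### T-ii DECK INVOLUTION `ι : (s, A, ξ) ↦ (−s, −A, −ξ)`, `η` and passengers fixed: `ι ∘ ψ_T = ψ_T`
(all four images are `ι`-even). -/

variable (ι : MvPolynomial (Fin n) k →ₐ[k] MvPolynomial (Fin n) k)
  (hιa : ι (X a) = -X a) (hιb : ι (X b) = -X b) (hιc : ι (X c) = -X c)
  (hι : ∀ i, i ≠ a → i ≠ b → i ≠ c → ι (X i) = X i)

include hab hac had hbc hbd hcd hιa hιb hιc hι in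
/-- **T-ii `ι ∘ ψ_T = ψ_T`**: the twisted chart factors through the `μ₂`-quotient by the deck
involution. [OURS · L1 W4.5c] -/
theorem deck_comp_twistedChart : ι.comp (twistedChart k n a b c d) = twistedChart k n a b c d := by
  have hιd : ι (X d) = X d := hι d (Ne.symm had) (Ne.symm hbd) (Ne.symm hcd)
  refine MvPolynomial.algHom_ext fun i => ?_
  change ι (twistedChart k n a b c d (X i)) = twistedChart k n a b c d (X i)
  by_cases hia : i = a
  · subst hia
    rw [twistedChart_X_a, map_mul, map_pow, hιa, hιb]; ring
  by_cases hib : i = b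
  · subst hib
    rw [twistedChart_X_b k n a i c d hab]
    simp only [map_mul, map_pow, map_add, map_one, hιa, hιb, hιc]; ring
  by_cases hic : i = c
  · subst hic
    rw [twistedChart_X_c k n a b i d hac hbc]
    simp only [twistedP, map_mul, map_pow, map_add, map_sub, MvPolynomial.algHom_C, MvPolynomial.algebraMap_eq, hιa, hιb, hιc,
      hιd]
    ring
  by_cases hid : i = d
  · subst hid
    rw [twistedChart_X_d k n a b c i had hbd hcd]
    simp only [map_mul, map_pow, map_add, map_sub, map_ofNat, MvPolynomial.algHom_C, MvPolynomial.algebraMap_eq, hιa, hιb, hιc,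
      hιd]
    ring
  rw [twistedChart_X_of_ne k n a b c d i hia hib hic hid, hι i hia hib hic]

include hab hac had hbc hbd hcd hιa hιb hιc hι in
/-- T-ii pointwise: `ι (ψ_T f) = ψ_T f`. [OURS · L1 W4.5c] -/
theorem deck_twistedChart (f : MvPolynomial (Fin n) k) :
    ι (twistedChart k n a b c d f) = twistedChart k n a b c d f := by
  have h := deck_comp_twistedChart k n a b c d hab hac had hbc hbd hcd ι hιa hιb hιc hι
  exact congrArg (fun φ : MvPolynomial (Fin n) k →ₐ[k] MvPolynomial (Fin n) k => φ f) h

include had hbd hcd hιa hιb hι in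
/-- `Q` is `ι`-even. [OURS · L1 W4.5c] -/
theorem deck_twistedQ : ι (twistedQ k n a b d) = twistedQ k n a b d := by
  have hιd : ι (X d) = X d := hι d (Ne.symm had) (Ne.symm hbd) (Ne.symm hcd)
  simp only [twistedQ, map_add, map_sub, map_mul, map_pow, map_one, map_ofNat, hιa, hιb, hιd]
  ring

/-! ### T-iv the generators of `I₆` on the chart: `ψ_T(g_j) = s⁶ · q_j`, and `I₆ · k[s,A,ξ,η] = (s⁶)`. -/

include hab hac hbc in
/-- **T-iv `ψ_T(g_j) = s⁶ q_j`** for the eight generators of `I₆` (vector of record) and the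
`q`-vector of record `twistedCofactor`. [OURS · L1 W4.5c] -/
theorem twistedChart_I6 (j : Fin 8) :
    twistedChart k n a b c d ((![X a ^ 2, X a * X b ^ 2, X a * X b * X c, X a * X c ^ 3, X b ^ 3,
        X b ^ 2 * X c ^ 2, X b * X c ^ 4, X c ^ 6] : Fin 8 → MvPolynomial (Fin n) k) j) =
      X b ^ 6 * twistedCofactor k n a b c d j := by
  fin_cases j <;>
    simp [twistedCofactor, twistedChart_X_a, twistedChart_X_b k n a b c d hab,
      twistedChart_X_c k n a b c d hac hbc] <;> ring

/-- **`q₀ = A²` and `q₄ = (1 + Aξ)³` are coprime** (`(−ξ)·A + 1·(1 + Aξ) = 1`). [OURS · L1 W4.5c] -/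
theorem isCoprime_twistedCofactor_zero_four :
    IsCoprime (twistedCofactor k n a b c d 0) (twistedCofactor k n a b c d 4) := by
  have h : IsCoprime (X a : MvPolynomial (Fin n) k) (1 + X a * X c) :=
    ⟨-X c, 1, by ring⟩
  simpa [twistedCofactor] using h.pow (m := 2) (n := 3)

include hab hac hbc in
/-- **`I₆ · k[s, A, ξ, η] = (s⁶)`**: the extension of `I₆` along `ψ_T` is the principal ideal
`(X b ^ 6)` — so `ψ_T` lifts to the blow-up `Bl_{I₆} 𝔸ⁿ`, with exceptional divisor `{s = 0}`.
[OURS · L1 W4.5c] -/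
theorem map_twistedChart_span_I6 :
    Ideal.map (twistedChart k n a b c d) (Ideal.span (Set.range
      (![X a ^ 2, X a * X b ^ 2, X a * X b * X c, X a * X c ^ 3, X b ^ 3, X b ^ 2 * X c ^ 2,
        X b * X c ^ 4, X c ^ 6] : Fin 8 → MvPolynomial (Fin n) k))) =
      Ideal.span {(X b ^ 6 : MvPolynomial (Fin n) k)} := by
  apply le_antisymm
  · rw [Ideal.map_span, Ideal.span_le]
    rintro _ ⟨_, ⟨j, rfl⟩, rfl⟩
    rw [SetLike.mem_coe, twistedChart_I6 k n a b c d hab hac hbc j]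
    exact Ideal.mul_mem_right _ _ (Ideal.subset_span rfl)
  · rw [Ideal.span_le, Set.singleton_subset_iff, SetLike.mem_coe]
    obtain ⟨u, v, huv⟩ := isCoprime_twistedCofactor_zero_four k n a b c d
    have h0 : X b ^ 6 * twistedCofactor k n a b c d 0 ∈
        Ideal.map (twistedChart k n a b c d) (Ideal.span (Set.range
          (![X a ^ 2, X a * X b ^ 2, X a * X b * X c, X a * X c ^ 3, X b ^ 3, X b ^ 2 * X c ^ 2,
            X b * X c ^ 4, X c ^ 6] : Fin 8 → MvPolynomial (Fin n) k))) := by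
      rw [← twistedChart_I6 k n a b c d hab hac hbc 0]
      exact Ideal.mem_map_of_mem _ (Ideal.subset_span ⟨0, rfl⟩)
    have h4 : X b ^ 6 * twistedCofactor k n a b c d 4 ∈
        Ideal.map (twistedChart k n a b c d) (Ideal.span (Set.range
          (![X a ^ 2, X a * X b ^ 2, X a * X b * X c, X a * X c ^ 3, X b ^ 3, X b ^ 2 * X c ^ 2,
            X b * X c ^ 4, X c ^ 6] : Fin 8 → MvPolynomial (Fin n) k))) := by
      rw [← twistedChart_I6 k n a b c d hab hac hbc 4]
      exact Ideal.mem_map_of_mem _ (Ideal.subset_span ⟨4, rfl⟩)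
    have e : (X b ^ 6 : MvPolynomial (Fin n) k) =
        u * (X b ^ 6 * twistedCofactor k n a b c d 0) + v * (X b ^ 6 * twistedCofactor k n a b c d 4) := by
      linear_combination (-(X b ^ 6 : MvPolynomial (Fin n) k)) * huv
    rw [e]
    exact Ideal.add_mem _ (Ideal.mul_mem_left _ _ h0) (Ideal.mul_mem_left _ _ h4)

end Identities

end Summit.ResolutionOfSingularities.ResolutionOfSingularities.Theorems.WildQuotientResolution.JordanFour

end
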